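import Summits.ResolutionOfSingularities.ResolutionOfSingularities.Theorems.FrobeniusClosingPatchingRelPerfectDepthPocketInvariant
import Summits.ResolutionOfSingularities.ResolutionOfSingularities.Theorems.FrobeniusClosingPatchingRelPerfectDepthSNCPointwiseCongr
import HarnessLib

/-!
# Crux `PatchingRelPerfect` (stmt-ResolutionOfSingularities-16161), chain W5.2 — END-SNC off `E′`:
# the pocket invariant with a USER-SUPPLIED host transform

[OURS · L1 W5.2 · rung tool] Replaces the role of NO printed item; NOT a statement of the manuscript under review; fact-free.
res-D-pv-052's X-side format `MixedFormatB` (TargetsF5J v5 e27dfed95ff23f74, instance `P`) steps the GLOBAL host factor as a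
CONTROLLED transform `𝓐′ = σᶜ(𝓐, m)`, while `DepthSNC.pocketSNC_step` (`…DepthPocketInvariant.lean`, p512884) transports the
family member-wise by STRICT transforms. This file restates the propagation of the pocket invariant
«`∀ x ∈ cosupp K ∖ i(E)`, `SNCWithAt (𝓐 :: L) ⊤ x`» with the new host `𝓐′` supplied by the caller, under the stalk
hypothesis `𝓐′_{x′} = (strictTransformIdeal σ Ĉ 𝓐)_{x′}` at the points where the invariant is read (res-D-pv-052's ask,
2026-08-27T08:18:47Z), and the non-degeneracy clause «the strict transform of the host is not one of the new boundary members»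
(dischargeable from traces: `σᶜ ≤ strictTransformIdeal`, so equality with a boundary member `G′` would give `D′ ≤ G′|_{E′}`,
against the carried «host has no boundary component»):

* `pocketSNC_step_host` — the propagation with user-supplied host;
* `strictTransformIdeal_ne_of_comap_not_le` — the trace test for the non-degeneracy clause.

## References
* J. Kollár, *Lectures on Resolution of Singularities* (2007), Def. 3.25, (3.111) Step 3. [Kollar2007]
* E. Bierstone, D. Grigoriev, P. Milman, J. Włodarczyk, arXiv:1206.3090, Def. 3.1.3 (2), (4), §3.2. [BierstoneGrigorievMilmanWlodarczyk2011]
-/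

-- `Summit.<Summit>.<Sub>.Theorems` with `Sub = Summit` (single-conjunct summit, D-0017)
set_option linter.dupNamespace false

noncomputable section

open CategoryTheory CategoryTheory.Limits AlgebraicGeometry TopologicalSpace IsLocalRing
open Literature.AlgebraicGeometry.Resolution
open Scheme.IdealSheafData

namespace Summit.ResolutionOfSingularities.ResolutionOfSingularities.Theorems

universe u

namespace DepthSNC

variable {E X E' X' : Scheme.{u}}

/-- [OURS · L1 W5.2] **PROPAGATION OF THE POCKET INVARIANT, host supplied by the caller.** As `pocketSNC_step`, for a
family `𝓐 :: L` (host first) and a new family `𝓐′ :: L′`: the tail `L′` is a sub-family of the transformed family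
`L.map (strictTransformIdeal σ Ĉ) ++ [Ĉ𝒪]` (at the points through which its members pass), the new host `𝓐′` has the stalk
of `strictTransformIdeal σ Ĉ 𝓐` at every cosupport point of `K′` off `i′(E′)` through which either passes, and
`strictTransformIdeal σ Ĉ 𝓐 ∉ L′` (non-degeneracy). [cite: Kollar2007, Def. 3.25] -/
theorem pocketSNC_step_host [IsLocallyNoetherian X] {σ : X' ⟶ X} {Ch : X.IdealSheafData} (hσ : IsBlowup σ Ch)
    {i : E ⟶ X} {i' : E' ⟶ X'}
    (hrange : ∀ x' : X', σ.base x' ∈ Set.range i.base →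
      x' ∈ Set.range i'.base ∨ σ.base x' ∈ (Ch.support : Set X))
    {K : X.IdealSheafData} {K' : X'.IdealSheafData}
    (hK' : ∀ x' : X', x' ∈ (K'.support : Set X') → σ.base x' ∈ (K.support : Set X))
    {𝓐 : X.IdealSheafData} {L : List X.IdealSheafData} {𝓐' : X'.IdealSheafData} {L' : List X'.IdealSheafData}
    (hL' : ∀ D ∈ L', ∀ x' : X', x' ∈ D.support → D ∈ L.map (strictTransformIdeal σ Ch) ++ [Ch.comap σ])
    (hne : strictTransformIdeal σ Ch 𝓐 ∉ L')
    (h𝓐' : ∀ x' : X', x' ∈ (K'.support : Set X') → x' ∉ Set.range i'.base →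
      stalkIdeal 𝓐' x' = stalkIdeal (strictTransformIdeal σ Ch 𝓐) x')
    (hfrozen : ∀ x : X, x ∈ (K.support : Set X) → x ∉ Set.range i.base → SNCWithAt (𝓐 :: L) ⊤ x)
    (hpocket : ∀ x' : X', x' ∈ (K'.support : Set X') → x' ∉ Set.range i'.base →
      σ.base x' ∈ (Ch.support : Set X) → SNCWithAt (𝓐 :: L) Ch (σ.base x')) :
    ∀ x' : X', x' ∈ (K'.support : Set X') → x' ∉ Set.range i'.base → SNCWithAt (𝓐' :: L') ⊤ x' := by
  intro x' hx'K hx'E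
  -- the member-wise transport, with the full transformed tail
  have h1 : SNCWithAt ((𝓐 :: L).map (strictTransformIdeal σ Ch) ++ [Ch.comap σ]) ⊤ x' :=
    pocketSNC_step hσ hrange hK' (Es' := (𝓐 :: L).map (strictTransformIdeal σ Ch) ++ [Ch.comap σ])
      (fun D hD _ _ => hD) hfrozen hpocket x' hx'K hx'E
  -- shrink the tail to `L'`
  have h2 : SNCWithAt (strictTransformIdeal σ Ch 𝓐 :: L') ⊤ x' := by
    refine h1.anti fun D hD hx => ?_
    rcases List.mem_cons.mp hD with rfl | hDL'
    · exact List.mem_append_left _ (List.mem_cons_self)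
    · have h := hL' D hDL' x' hx
      rw [List.map_cons, List.cons_append]
      exact List.mem_cons_of_mem _ h
  -- replace the head by the supplied host
  exact h2.replace_head hne (h𝓐' x' hx'K hx'E)

/-- **Trace test for the non-degeneracy clause**: if an ideal sheaf `𝓐′ ≤ strictTransformIdeal σ Ĉ 𝓐` (e.g. a controlled
transform, `controlledTransform_le_strictTransformIdeal`) has trace `𝓐′|_{E′} = D′` along `i′`, and `D′ ≰ G′|_{E′}`, then
`strictTransformIdeal σ Ĉ 𝓐 ≠ G′`. [folklore] -/
theorem strictTransformIdeal_ne_of_comap_not_le {σ : X' ⟶ X} {Ch 𝓐 : X.IdealSheafData} {i' : E' ⟶ X'}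
    {𝓐' G' : X'.IdealSheafData} (hle : 𝓐' ≤ strictTransformIdeal σ Ch 𝓐) {D' : E'.IdealSheafData}
    (htr : 𝓐'.comap i' = D') (hnot : ¬ D' ≤ G'.comap i') : strictTransformIdeal σ Ch 𝓐 ≠ G' := by
  intro h
  apply hnot
  rw [← htr, ← h]
  exact Scheme.IdealSheafData.comap_mono (f := i') hle

/-- The list form of the trace test: `strictTransformIdeal σ Ĉ 𝓐 ∉ L′` as soon as every member of `L′` has a trace not
containing the host trace. [folklore] -/
theorem strictTransformIdeal_not_mem_of_traces {σ : X' ⟶ X} {Ch 𝓐 : X.IdealSheafData} {i' : E' ⟶ X'}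
    {𝓐' : X'.IdealSheafData} (hle : 𝓐' ≤ strictTransformIdeal σ Ch 𝓐) {D' : E'.IdealSheafData}
    (htr : 𝓐'.comap i' = D') {L' : List X'.IdealSheafData} (hnot : ∀ G' ∈ L', ¬ D' ≤ G'.comap i') :
    strictTransformIdeal σ Ch 𝓐 ∉ L' :=
  fun h => strictTransformIdeal_ne_of_comap_not_le hle htr (hnot _ h) rfl


/-! ## The POINTWISE form (rev 2): hypotheses asked only at the points where the invariant is read -/

/-- [OURS · L1 W5.2] **PROPAGATION OF THE POCKET INVARIANT, host supplied by the caller — POINTWISE hypotheses.** As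
`pocketSNC_step_host`, but the sub-family clause, the stalk clause and the non-degeneracy clause are asked only at the cosupport
points of `K′` off `i′(E′)` (where the invariant is read): there `i′.ker` passes through no such point, so the exceptional
hypersurface member of the new family owes nothing, and the non-degeneracy «`strictTransformIdeal σ Ĉ 𝓐` is none of the new
members THROUGH THE POINT» is dischargeable member by member from traces (`strictTransformIdeal_ne_of_comap_not_le`).
(res-D-pv-052's `MixedFormatB`: family `𝓐 :: i.ker :: charged 𝒢 𝒩`.) [cite: Kollar2007, Def. 3.25] -/
theorem pocketSNC_step_host' [IsLocallyNoetherian X] {σ : X' ⟶ X} {Ch : X.IdealSheafData} (hσ : IsBlowup σ Ch)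
    {i : E ⟶ X} {i' : E' ⟶ X'}
    (hrange : ∀ x' : X', σ.base x' ∈ Set.range i.base →
      x' ∈ Set.range i'.base ∨ σ.base x' ∈ (Ch.support : Set X))
    {K : X.IdealSheafData} {K' : X'.IdealSheafData}
    (hK' : ∀ x' : X', x' ∈ (K'.support : Set X') → σ.base x' ∈ (K.support : Set X))
    {𝓐 : X.IdealSheafData} {L : List X.IdealSheafData} {𝓐' : X'.IdealSheafData} {L' : List X'.IdealSheafData}
    (hL' : ∀ x' : X', x' ∈ (K'.support : Set X') → x' ∉ Set.range i'.base →
      ∀ D ∈ L', x' ∈ D.support → D ∈ L.map (strictTransformIdeal σ Ch) ++ [Ch.comap σ])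
    (hne : ∀ x' : X', x' ∈ (K'.support : Set X') → x' ∉ Set.range i'.base →
      ∀ D ∈ L', x' ∈ D.support → D ≠ strictTransformIdeal σ Ch 𝓐)
    (h𝓐' : ∀ x' : X', x' ∈ (K'.support : Set X') → x' ∉ Set.range i'.base →
      stalkIdeal 𝓐' x' = stalkIdeal (strictTransformIdeal σ Ch 𝓐) x')
    (hfrozen : ∀ x : X, x ∈ (K.support : Set X) → x ∉ Set.range i.base → SNCWithAt (𝓐 :: L) ⊤ x)
    (hpocket : ∀ x' : X', x' ∈ (K'.support : Set X') → x' ∉ Set.range i'.base →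
      σ.base x' ∈ (Ch.support : Set X) → SNCWithAt (𝓐 :: L) Ch (σ.base x')) :
    ∀ x' : X', x' ∈ (K'.support : Set X') → x' ∉ Set.range i'.base → SNCWithAt (𝓐' :: L') ⊤ x' := by
  classical
  haveI : IsProper σ := hσ.isProper
  haveI : IsLocallyNoetherian X' := LocallyOfFiniteType.isLocallyNoetherian σ
  intro x' hx'K hx'E
  -- the member-wise transport at `x'`, full transformed family
  have h1 : SNCWithAt ((𝓐 :: L).map (strictTransformIdeal σ Ch) ++ [Ch.comap σ]) ⊤ x' := by
    by_cases hxC : σ.base x' ∈ (Ch.support : Set X)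
    · exact hσ.sncWithAt_transform_of_mem_support x' (hpocket x' hx'K hx'E hxC) hxC
    · have hxE : σ.base x' ∉ Set.range i.base := by
        intro h
        rcases hrange x' h with h2 | h2
        · exact hx'E h2
        · exact hxC h2
      have h := hfrozen _ (hK' x' hx'K) hxE
      exact (hσ.sncWithAt_transform_of_not_mem_support x' (h.of_not_mem_support hxC) hxC).top
  -- the assignment of members of `𝓐' :: L'` through `x'` to members of the transformed family through `x'`
  have hmemA : x' ∈ 𝓐'.support → x' ∈ (strictTransformIdeal σ Ch 𝓐).support :=
    (mem_support_iff_of_stalkIdeal_eq (h𝓐' x' hx'K hx'E)).mp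
  have hbig : ∀ D ∈ L', x' ∈ D.support → D ∈ (𝓐 :: L).map (strictTransformIdeal σ Ch) ++ [Ch.comap σ] := by
    intro D hD hx
    have h := hL' x' hx'K hx'E D hD hx
    rw [List.map_cons, List.cons_append]
    exact List.mem_cons_of_mem _ h
  have hheadmem : strictTransformIdeal σ Ch 𝓐 ∈ (𝓐 :: L).map (strictTransformIdeal σ Ch) ++ [Ch.comap σ] := by
    rw [List.map_cons, List.cons_append]
    exact List.mem_cons_self
  let f : {D' : X'.IdealSheafData // D' ∈ 𝓐' :: L' ∧ x' ∈ D'.support} →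
      {D : X'.IdealSheafData // D ∈ (𝓐 :: L).map (strictTransformIdeal σ Ch) ++ [Ch.comap σ] ∧ x' ∈ D.support} :=
    fun D' =>
      if hD : D'.1 = 𝓐' then ⟨strictTransformIdeal σ Ch 𝓐, hheadmem, hmemA (hD ▸ D'.2.2)⟩
      else ⟨D'.1, hbig D'.1 ((List.mem_cons.mp D'.2.1).resolve_left hD) D'.2.2, D'.2.2⟩
  have hf_val : ∀ D', (f D').1 = if D'.1 = 𝓐' then strictTransformIdeal σ Ch 𝓐 else D'.1 := by
    intro D'
    by_cases hD : D'.1 = 𝓐'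
    · simp only [f, dif_pos hD, if_pos hD]
    · simp only [f, dif_neg hD, if_neg hD]
  refine h1.of_stalk_eq f ?_ ?_
  · intro D₁ D₂ heq
    have hv := congrArg Subtype.val heq
    rw [hf_val, hf_val] at hv
    apply Subtype.ext
    by_cases h₁ : D₁.1 = 𝓐' <;> by_cases h₂ : D₂.1 = 𝓐'
    · rw [h₁, h₂]
    · exfalso
      rw [if_pos h₁, if_neg h₂] at hv
      exact hne x' hx'K hx'E D₂.1 ((List.mem_cons.mp D₂.2.1).resolve_left h₂) D₂.2.2 hv.symm
    · exfalso
      rw [if_neg h₁, if_pos h₂] at hv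
      exact hne x' hx'K hx'E D₁.1 ((List.mem_cons.mp D₁.2.1).resolve_left h₁) D₁.2.2 hv
    · rw [if_neg h₁, if_neg h₂] at hv
      exact hv
  · intro D'
    rw [hf_val]
    by_cases hD : D'.1 = 𝓐'
    · rw [if_pos hD, hD, h𝓐' x' hx'K hx'E]
    · rw [if_neg hD]

end DepthSNC

end Summit.ResolutionOfSingularities.ResolutionOfSingularities.Theorems

end
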